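import Summits.CriticalPhenomena.PercolationContinuityZ3.Theorems.PercNearOneGluingNoHeavyLowerTailStarSetFamilyA0
import HarnessLib

/-!
# `NoHeavyLowerTail` (stmt-CriticalPhenomena-4575) — shapes of the residual class-sets (U1-PROOF.md §9; blueprint §G4)

Support file (prover `prim-gen-swap` gen 15; `--supports stmt-CriticalPhenomena-4575`).  No definitions, no named facts, no sorries.

The ledger of the residual bound files every residual word under a class-set `T` that is NOT an r-free triangle (`TRIS`) and, except
for the far-rider words, NOT a regular triple (`REGT`).  The geometric facts used: three classes through a common port, or a class-set
with a class through `r`, or one whose classes show four distinct ports, is not an r-free triangle; a common port or a class through `r`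
also excludes the regular shape, and so does "every chord of `T` has a port met by no other class of `T`" (the middle class of a regular
triple is a chord met at both ports); finally the far-rider triple `{X, J, ρ}` (hub `X = {e, ē} ∉ F`, `J ∋ e`, `ρ ∋ ē`) IS a regular triple.

* `StarSet.not_tri_of_common_port`, `StarSet.not_rsh_of_common_port`, `StarSet.not_tri_of_r_mem`, `StarSet.not_rsh_of_r_mem`,
  `StarSet.not_tri_of_four_ports`, `StarSet.rsh_middle`, `StarSet.not_rsh_of_uncovered_port`, `StarSet.rsh_of_ports`.
-/

namespace Summit.CriticalPhenomena.PercolationContinuityZ3.Theorems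

open Finset
open scoped BigOperators Classical

namespace StarSet

variable {ι V : Type*} [DecidableEq ι] [DecidableEq V]

omit [DecidableEq V] in
/-- Three classes through a common port are not an r-free triangle. -/
theorem not_tri_of_common_port (P P' : ι → V) (r : V) (T : Finset ι) (e : V) (he : ∀ K ∈ T, P K = e ∨ P' K = e) :
    ¬ ∃ (a b c : V) (X Y Z : ι), a ≠ b ∧ a ≠ c ∧ b ≠ c ∧ a ≠ r ∧ b ≠ r ∧ c ≠ r ∧
      (s(P X, P' X) : Sym2 V) = s(a, b) ∧ (s(P Y, P' Y) : Sym2 V) = s(a, c) ∧ (s(P Z, P' Z) : Sym2 V) = s(b, c) ∧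
      T = {X, Y, Z} := by
  rintro ⟨a, b, c, X, Y, Z, hab, hac, hbc, -, -, -, hX, hY, hZ, rfl⟩
  have h1 := (ports_iff_of_pair P P' hX e).1 (he X (by simp))
  have h2 := (ports_iff_of_pair P P' hY e).1 (he Y (by simp))
  have h3 := (ports_iff_of_pair P P' hZ e).1 (he Z (by simp))
  rcases h1 with rfl | rfl
  · rcases h3 with h | h; exacts [hab h, hac h]
  · rcases h2 with h | h; exacts [hab h.symm, hbc h]

omit [DecidableEq V] in
/-- Three classes through a common port are not a regular triple. -/
theorem not_rsh_of_common_port (P P' : ι → V) (r : V) (F : Finset ι) (T : Finset ι) (e : V)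
    (he : ∀ K ∈ T, P K = e ∨ P' K = e) :
    ¬ ∃ (M E₁ E₂ : ι) (q₁ q₂ f₁ f₂ : V),
          M ∉ F ∧ (s(P M, P' M) : Sym2 V) = s(q₁, q₂) ∧ (s(P E₁, P' E₁) : Sym2 V) = s(q₁, f₁) ∧
          (s(P E₂, P' E₂) : Sym2 V) = s(q₂, f₂) ∧ q₁ ≠ q₂ ∧ f₁ ≠ q₁ ∧ f₁ ≠ q₂ ∧ f₂ ≠ q₁ ∧ f₂ ≠ q₂ ∧
          q₁ ≠ r ∧ q₂ ≠ r ∧ f₁ ≠ r ∧ f₂ ≠ r ∧ T = {M, E₁, E₂} := by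
  rintro ⟨M, E₁, E₂, q₁, q₂, f₁, f₂, -, hM, hE₁, hE₂, hq, hf1q1, hf1q2, hf2q1, hf2q2, -, -, -, -, rfl⟩
  have h1 := (ports_iff_of_pair P P' hM e).1 (he M (by simp))
  have h2 := (ports_iff_of_pair P P' hE₁ e).1 (he E₁ (by simp))
  have h3 := (ports_iff_of_pair P P' hE₂ e).1 (he E₂ (by simp))
  rcases h1 with rfl | rfl
  · rcases h3 with h | h; exacts [hq h, hf2q1 h.symm]
  · rcases h2 with h | h; exacts [hq h.symm, hf1q2 h.symm]

omit [DecidableEq V] in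
/-- A class-set with a class through `r` is not an r-free triangle. -/
theorem not_tri_of_r_mem (P P' : ι → V) (r : V) (T : Finset ι) (hr : ∃ K ∈ T, P K = r ∨ P' K = r) :
    ¬ ∃ (a b c : V) (X Y Z : ι), a ≠ b ∧ a ≠ c ∧ b ≠ c ∧ a ≠ r ∧ b ≠ r ∧ c ≠ r ∧
      (s(P X, P' X) : Sym2 V) = s(a, b) ∧ (s(P Y, P' Y) : Sym2 V) = s(a, c) ∧ (s(P Z, P' Z) : Sym2 V) = s(b, c) ∧
      T = {X, Y, Z} := by
  rintro ⟨a, b, c, X, Y, Z, -, -, -, har, hbr, hcr, hX, hY, hZ, rfl⟩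
  obtain ⟨K, hK, hKr⟩ := hr
  simp only [mem_insert, mem_singleton] at hK
  rcases hK with hK | hK | hK <;> rw [hK] at hKr
  · rcases (ports_iff_of_pair P P' hX r).1 hKr with h | h; exacts [har h.symm, hbr h.symm]
  · rcases (ports_iff_of_pair P P' hY r).1 hKr with h | h; exacts [har h.symm, hcr h.symm]
  · rcases (ports_iff_of_pair P P' hZ r).1 hKr with h | h; exacts [hbr h.symm, hcr h.symm]

omit [DecidableEq V] in
/-- A class-set with a class through `r` is not a regular triple. -/
theorem not_rsh_of_r_mem (P P' : ι → V) (r : V) (F : Finset ι) (T : Finset ι) (hr : ∃ K ∈ T, P K = r ∨ P' K = r) :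
    ¬ ∃ (M E₁ E₂ : ι) (q₁ q₂ f₁ f₂ : V),
          M ∉ F ∧ (s(P M, P' M) : Sym2 V) = s(q₁, q₂) ∧ (s(P E₁, P' E₁) : Sym2 V) = s(q₁, f₁) ∧
          (s(P E₂, P' E₂) : Sym2 V) = s(q₂, f₂) ∧ q₁ ≠ q₂ ∧ f₁ ≠ q₁ ∧ f₁ ≠ q₂ ∧ f₂ ≠ q₁ ∧ f₂ ≠ q₂ ∧
          q₁ ≠ r ∧ q₂ ≠ r ∧ f₁ ≠ r ∧ f₂ ≠ r ∧ T = {M, E₁, E₂} := by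
  rintro ⟨M, E₁, E₂, q₁, q₂, f₁, f₂, -, hM, hE₁, hE₂, -, -, -, -, -, hq1r, hq2r, hf1r, hf2r, rfl⟩
  obtain ⟨K, hK, hKr⟩ := hr
  simp only [mem_insert, mem_singleton] at hK
  rcases hK with hK | hK | hK <;> rw [hK] at hKr
  · rcases (ports_iff_of_pair P P' hM r).1 hKr with h | h; exacts [hq1r h.symm, hq2r h.symm]
  · rcases (ports_iff_of_pair P P' hE₁ r).1 hKr with h | h; exacts [hq1r h.symm, hf1r h.symm]
  · rcases (ports_iff_of_pair P P' hE₂ r).1 hKr with h | h; exacts [hq2r h.symm, hf2r h.symm]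

/-- A class-set whose classes show four distinct ports is not an r-free triangle. -/
theorem not_tri_of_four_ports (P P' : ι → V) (r : V) (T : Finset ι) (p₁ p₂ p₃ p₄ : V)
    (h12 : p₁ ≠ p₂) (h13 : p₁ ≠ p₃) (h14 : p₁ ≠ p₄) (h23 : p₂ ≠ p₃) (h24 : p₂ ≠ p₄) (h34 : p₃ ≠ p₄)
    (hp₁ : ∃ K ∈ T, P K = p₁ ∨ P' K = p₁) (hp₂ : ∃ K ∈ T, P K = p₂ ∨ P' K = p₂)
    (hp₃ : ∃ K ∈ T, P K = p₃ ∨ P' K = p₃) (hp₄ : ∃ K ∈ T, P K = p₄ ∨ P' K = p₄) :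
    ¬ ∃ (a b c : V) (X Y Z : ι), a ≠ b ∧ a ≠ c ∧ b ≠ c ∧ a ≠ r ∧ b ≠ r ∧ c ≠ r ∧
      (s(P X, P' X) : Sym2 V) = s(a, b) ∧ (s(P Y, P' Y) : Sym2 V) = s(a, c) ∧ (s(P Z, P' Z) : Sym2 V) = s(b, c) ∧
      T = {X, Y, Z} := by
  rintro ⟨a, b, c, X, Y, Z, -, -, -, -, -, -, hX, hY, hZ, rfl⟩
  -- every port of a class of `T` is one of `a, b, c`
  have hport : ∀ p, (∃ K ∈ ({X, Y, Z} : Finset ι), P K = p ∨ P' K = p) → p ∈ ({a, b, c} : Finset V) := by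
    rintro p ⟨K, hK, hKp⟩
    simp only [mem_insert, mem_singleton] at hK ⊢
    rcases hK with hK | hK | hK <;> rw [hK] at hKp
    · rcases (ports_iff_of_pair P P' hX p).1 hKp with h | h; exacts [Or.inl h, Or.inr (Or.inl h)]
    · rcases (ports_iff_of_pair P P' hY p).1 hKp with h | h; exacts [Or.inl h, Or.inr (Or.inr h)]
    · rcases (ports_iff_of_pair P P' hZ p).1 hKp with h | h; exacts [Or.inr (Or.inl h), Or.inr (Or.inr h)]
  have hsub : ({p₁, p₂, p₃, p₄} : Finset V) ⊆ {a, b, c} := by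
    intro p hp
    simp only [mem_insert, mem_singleton] at hp
    rcases hp with rfl | rfl | rfl | rfl
    exacts [hport _ hp₁, hport _ hp₂, hport _ hp₃, hport _ hp₄]
  have hcard : ({p₁, p₂, p₃, p₄} : Finset V).card = 4 := by
    rw [card_insert_of_notMem (by simp [h12, h13, h14]), card_insert_of_notMem (by simp [h23, h24]),
      card_insert_of_notMem (by simp [h34]), card_singleton]
  have := card_le_card hsub
  rw [hcard] at this
  exact absurd (this.trans Finset.card_le_three) (by norm_num)

omit [DecidableEq V] in
/-- The middle class of a regular triple is a chord met by the other two classes at both its ports. -/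
theorem rsh_middle (P P' : ι → V) (r : V) (F : Finset ι) (T : Finset ι)
    (hrsh : ∃ (M E₁ E₂ : ι) (q₁ q₂ f₁ f₂ : V),
          M ∉ F ∧ (s(P M, P' M) : Sym2 V) = s(q₁, q₂) ∧ (s(P E₁, P' E₁) : Sym2 V) = s(q₁, f₁) ∧
          (s(P E₂, P' E₂) : Sym2 V) = s(q₂, f₂) ∧ q₁ ≠ q₂ ∧ f₁ ≠ q₁ ∧ f₁ ≠ q₂ ∧ f₂ ≠ q₁ ∧ f₂ ≠ q₂ ∧
          q₁ ≠ r ∧ q₂ ≠ r ∧ f₁ ≠ r ∧ f₂ ≠ r ∧ T = {M, E₁, E₂}) :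
    ∃ M ∈ T, M ∉ F ∧ (∃ K ∈ T, K ≠ M ∧ (P K = P M ∨ P' K = P M)) ∧ (∃ K ∈ T, K ≠ M ∧ (P K = P' M ∨ P' K = P' M)) := by
  obtain ⟨M, E₁, E₂, q₁, q₂, f₁, f₂, hMF, hM, hE₁, hE₂, hq, hf1q1, hf1q2, hf2q1, -, -, -, -, -, rfl⟩ := hrsh
  have hE₁M : E₁ ≠ M := by
    intro h; rw [h, hM] at hE₁
    rcases Sym2.eq_iff.1 hE₁ with ⟨-, h2⟩ | ⟨h1, -⟩
    · exact hf1q2 h2.symm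
    · exact hf1q1 h1.symm
  have hE₂M : E₂ ≠ M := by
    intro h; rw [h, hM] at hE₂
    rcases Sym2.eq_iff.1 hE₂ with ⟨h1, -⟩ | ⟨h1, -⟩
    · exact hq h1
    · exact hf2q1 h1.symm
  have hE₁q : P E₁ = q₁ ∨ P' E₁ = q₁ := (ports_iff_of_pair P P' hE₁ q₁).2 (Or.inl rfl)
  have hE₂q : P E₂ = q₂ ∨ P' E₂ = q₂ := (ports_iff_of_pair P P' hE₂ q₂).2 (Or.inl rfl)
  refine ⟨M, by simp, hMF, ?_, ?_⟩
  · rcases Sym2.eq_iff.1 hM with ⟨hP, -⟩ | ⟨hP, -⟩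
    · exact ⟨E₁, by simp, hE₁M, by rw [hP]; exact hE₁q⟩
    · exact ⟨E₂, by simp, hE₂M, by rw [hP]; exact hE₂q⟩
  · rcases Sym2.eq_iff.1 hM with ⟨-, hP'⟩ | ⟨-, hP'⟩
    · exact ⟨E₂, by simp, hE₂M, by rw [hP']; exact hE₂q⟩
    · exact ⟨E₁, by simp, hE₁M, by rw [hP']; exact hE₁q⟩

omit [DecidableEq V] in
/-- If every chord of `T` has a port met by no other class of `T`, then `T` is not a regular triple. -/
theorem not_rsh_of_uncovered_port (P P' : ι → V) (r : V) (F : Finset ι) (T : Finset ι)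
    (hT : ∀ M ∈ T, M ∉ F → ∃ p, (P M = p ∨ P' M = p) ∧ ∀ K ∈ T, K ≠ M → ¬ (P K = p ∨ P' K = p)) :
    ¬ ∃ (M E₁ E₂ : ι) (q₁ q₂ f₁ f₂ : V),
          M ∉ F ∧ (s(P M, P' M) : Sym2 V) = s(q₁, q₂) ∧ (s(P E₁, P' E₁) : Sym2 V) = s(q₁, f₁) ∧
          (s(P E₂, P' E₂) : Sym2 V) = s(q₂, f₂) ∧ q₁ ≠ q₂ ∧ f₁ ≠ q₁ ∧ f₁ ≠ q₂ ∧ f₂ ≠ q₁ ∧ f₂ ≠ q₂ ∧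
          q₁ ≠ r ∧ q₂ ≠ r ∧ f₁ ≠ r ∧ f₂ ≠ r ∧ T = {M, E₁, E₂} := by
  intro hrsh
  obtain ⟨M, hM, hMF, ⟨K₁, hK₁, hK₁M, hK₁p⟩, ⟨K₂, hK₂, hK₂M, hK₂p⟩⟩ := rsh_middle P P' r F T hrsh
  obtain ⟨p, hMp, hp⟩ := hT M hM hMF
  rcases hMp with h | h
  · exact hp K₁ hK₁ hK₁M (by rw [← h]; exact hK₁p)
  · exact hp K₂ hK₂ hK₂M (by rw [← h]; exact hK₂p)

omit [DecidableEq V] in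
/-- **The far-rider triple is a regular triple**: hub `X = {e, ē} ∉ F`, `J` through `e` but not `ē`, `ρ` through `ē` but not `e`,
all ports off `r`. -/
theorem rsh_of_ports (P P' : ι → V) (hPP' : ∀ X, P X ≠ P' X) (r : V) (F : Finset ι) {X J ρ : ι} {e ē : V}
    (hXF : X ∉ F) (hX : (P X = e ∧ P' X = ē) ∨ (P X = ē ∧ P' X = e)) (heē : e ≠ ē) (her : e ≠ r) (hēr : ē ≠ r)
    (hJe : P J = e ∨ P' J = e) (hJē : ¬ (P J = ē ∨ P' J = ē)) (hJr : P J ≠ r ∧ P' J ≠ r)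
    (hρē : P ρ = ē ∨ P' ρ = ē) (hρe : ¬ (P ρ = e ∨ P' ρ = e)) (hρr : P ρ ≠ r ∧ P' ρ ≠ r) :
    ∃ (M E₁ E₂ : ι) (q₁ q₂ f₁ f₂ : V),
          M ∉ F ∧ (s(P M, P' M) : Sym2 V) = s(q₁, q₂) ∧ (s(P E₁, P' E₁) : Sym2 V) = s(q₁, f₁) ∧
          (s(P E₂, P' E₂) : Sym2 V) = s(q₂, f₂) ∧ q₁ ≠ q₂ ∧ f₁ ≠ q₁ ∧ f₁ ≠ q₂ ∧ f₂ ≠ q₁ ∧ f₂ ≠ q₂ ∧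
          q₁ ≠ r ∧ q₂ ≠ r ∧ f₁ ≠ r ∧ f₂ ≠ r ∧ ({X, J, ρ} : Finset ι) = {M, E₁, E₂} := by
  obtain ⟨f₁, hJ', hf₁e, hf₁ē, hf₁r⟩ : ∃ f₁, (s(P J, P' J) : Sym2 V) = s(e, f₁) ∧ f₁ ≠ e ∧ f₁ ≠ ē ∧ f₁ ≠ r := by
    rcases hJe with h | h
    · exact ⟨P' J, by rw [h], fun h' => hPP' J (h.trans h'.symm), fun h' => hJē (Or.inr h'), hJr.2⟩
    · exact ⟨P J, by rw [h]; exact Sym2.eq_swap, fun h' => hPP' J (h'.trans h.symm), fun h' => hJē (Or.inl h'), hJr.1⟩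
  obtain ⟨f₂, hρ', hf₂ē, hf₂e, hf₂r⟩ : ∃ f₂, (s(P ρ, P' ρ) : Sym2 V) = s(ē, f₂) ∧ f₂ ≠ ē ∧ f₂ ≠ e ∧ f₂ ≠ r := by
    rcases hρē with h | h
    · exact ⟨P' ρ, by rw [h], fun h' => hPP' ρ (h.trans h'.symm), fun h' => hρe (Or.inr h'), hρr.2⟩
    · exact ⟨P ρ, by rw [h]; exact Sym2.eq_swap, fun h' => hPP' ρ (h'.trans h.symm), fun h' => hρe (Or.inl h'), hρr.1⟩
  have hX' : (s(P X, P' X) : Sym2 V) = s(e, ē) := by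
    rcases hX with ⟨h1, h2⟩ | ⟨h1, h2⟩
    · rw [h1, h2]
    · rw [h1, h2]; exact Sym2.eq_swap
  exact ⟨X, J, ρ, e, ē, f₁, f₂, hXF, hX', hJ', hρ', heē, hf₁e, hf₁ē, hf₂e, hf₂ē, her, hēr, hf₁r, hf₂r, rfl⟩

end StarSet

end Summit.CriticalPhenomena.PercolationContinuityZ3.Theorems
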